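import Summits.AtomisticToContinuum.BoseEinsteinCondensation.Theses.BECConjugateDomination
import Literature.MathematicalPhysics.QuantumManyBody.LiebYngvasonBoxBound
import Literature.MathematicalPhysics.QuantumManyBody.LiebYngvasonCellMethod
import Literature.MathematicalPhysics.QuantumManyBody.BoseGasThermodynamicLimitProofs
import HarnessLib

/-!
# `PuffFloor` is vacuous for hard cores (negative-side lemma for crux `PuffFloor`, stmt-AtomisticToContinuum-11785)

Cycle-2 file of the refuter's negative-side chain for crux `PuffFloor` of route
`BECConjugateDomination` (cdisprove seat gen 2, 2026-08-16). LOAD-BEARING ANALYSIS of the class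
hypothesis `∀ r, v r ≠ ⊤` (finiteness of the potential):

* `periodicEnergy_eq_top_of_hardCore` — if `v = ⊤` on `[0, R₀)` (`R₀ > 0`), every periodic trial
  state of `N ≥ 2` particles that is pointwise non-zero has infinite periodic energy (the pair
  `(0,1)` lies inside the core on the box `(0,δ)^{3N}`, `δ = min L (R₀/2)`, of positive volume);
* `puffFloor_conclusion_vacuous_for_hardCore` — hence for such `v` the crux's entire inner
  statement (`∃ C ≥ 0 ∃ ρ₀ ∀ ρ ∀ᶠ n ∀ Ψ, minimiser → finite energy → real → nonzero → floor`) holds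
  with `C = 0`, VACUOUSLY: the hypotheses `periodicEnergy v Ψ ≠ ⊤` and `∀ X, Ψ X ≠ 0` contradict
  each other. So the finiteness hypothesis on `v` is a non-vacuity guard: dropping it can neither be
  refuted nor carries information, and a `PuffFloor`-type statement for hard cores must ask
  positivity only off the core (hard cores belong to `HardCoreExtension`).

No Theses statement is asserted positively. All `[folklore]`.
-/

noncomputable section

namespace Summit.AtomisticToContinuum.BoseEinsteinCondensation.Theorems.PuffFloor.Negative

open Literature.MathematicalPhysics.QuantumManyBody.BoseGas MeasureTheory Complex Finset
open scoped ComplexConjugate BigOperators ENNReal NNReal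

/-! ### Hard cores: the crux's inner hypotheses become jointly unsatisfiable (vacuity guard) -/

/-- Two points of the open box `(0, δ)³` are closer than `2δ`. [folklore] -/
theorem norm_sub_lt_of_mem_box {δ : ℝ} {x y : Space} (hx : x ∈ box δ) (hy : y ∈ box δ) :
    ‖x - y‖ < 2 * δ := by
  have hδ : 0 < δ := by have := hx 0; exact this.1.trans this.2
  have hcoord : ∀ k, ‖(x - y) k‖ ^ 2 ≤ δ ^ 2 := by
    intro k
    have h1 := hx k; have h2 := hy k
    rw [PiLp.sub_apply, Real.norm_eq_abs, sq_abs]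
    have : |x k - y k| ≤ δ := by
      rw [abs_sub_le_iff]; constructor <;> linarith [h1.1, h1.2, h2.1, h2.2]
    nlinarith [abs_nonneg (x k - y k), sq_abs (x k - y k)]
  have hsq : ‖x - y‖ ^ 2 < (2 * δ) ^ 2 := by
    rw [EuclideanSpace.norm_sq_eq]
    calc ∑ k, ‖(x - y) k‖ ^ 2 ≤ ∑ _k : Fin 3, δ ^ 2 := Finset.sum_le_sum fun k _ => hcoord k
      _ = 3 * δ ^ 2 := by simp
      _ < (2 * δ) ^ 2 := by nlinarith
  exact lt_of_pow_lt_pow_left₀ 2 (by positivity) hsq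

/-- **For a hard core the inner hypotheses of the crux are contradictory**: if `v = ⊤` on
`[0, R₀)` (`R₀ > 0`), every periodic trial state of `N ≥ 2` particles that is pointwise non-zero
has INFINITE periodic energy (the pair `(0,1)` sits inside the core on the small box `(0,δ)^{3N}`,
`δ = min L (R₀/2)`, of positive volume, where `|Ψ|² > 0`). [folklore] -/
theorem periodicEnergy_eq_top_of_hardCore {N : ℕ} {L R₀ : ℝ} (hL : 0 < L) (hR : 0 < R₀)
    (hN : 2 ≤ N) {v : ℝ → ℝ≥0∞} (hv : ∀ r, 0 ≤ r → r < R₀ → v r = ⊤)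
    (Ψ : PeriodicTrialState N L) (hΨ : ∀ X, Ψ.ψ X ≠ 0) : periodicEnergy v Ψ = ⊤ := by
  set δ : ℝ := min L (R₀ / 2) with hδ
  have hδpos : 0 < δ := lt_min hL (by positivity)
  have hδL : δ ≤ L := min_le_left _ _
  have hδR : 2 * δ ≤ R₀ := by
    have := min_le_right L (R₀ / 2); linarith
  let i₀ : Fin N := ⟨0, by omega⟩
  let i₁ : Fin N := ⟨1, by omega⟩
  have hi : i₀ < i₁ := Fin.mk_lt_mk.2 zero_lt_one
  -- on the small box the interaction is `⊤`
  have hint : ∀ X ∈ boxN N δ, periodicInteraction v L X = ⊤ := by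
    intro X hX
    have hclose : ‖X i₀ - X i₁‖ < R₀ :=
      (norm_sub_lt_of_mem_box (hX i₀) (hX i₁)).trans_le hδR
    have htop : periodizedPotential v L (X i₀ - X i₁) = ⊤ := by
      refine top_le_iff.1 ?_
      calc (⊤ : ℝ≥0∞) = v ‖X i₀ - X i₁‖ := (hv _ (norm_nonneg _) hclose).symm
        _ ≤ periodizedPotential v L (X i₀ - X i₁) := le_periodizedPotential v L _
    refine top_le_iff.1 ?_
    calc (⊤ : ℝ≥0∞) = periodizedPotential v L (X i₀ - X i₁) := htop.symm
      _ ≤ ∑ j ∈ Finset.univ.filter (fun j => i₀ < j), periodizedPotential v L (X i₀ - X j) :=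
          Finset.single_le_sum (f := fun j => periodizedPotential v L (X i₀ - X j))
            (fun _ _ => zero_le) (Finset.mem_filter.2 ⟨Finset.mem_univ _, hi⟩)
      _ ≤ periodicInteraction v L X :=
          Finset.single_le_sum
            (f := fun i => ∑ j ∈ Finset.univ.filter (fun j => i < j),
              periodizedPotential v L (X i - X j))
            (fun _ _ => zero_le) (Finset.mem_univ i₀)
  -- hence the energy density is `⊤` there
  have hdens : ∀ X ∈ boxN N δ,
      kineticDensity Ψ.ψ X + periodicInteraction v L X * (‖Ψ.ψ X‖₊ : ℝ≥0∞) ^ 2 = ⊤ := by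
    intro X hX
    rw [hint X hX, ENNReal.top_mul, add_top]
    exact pow_ne_zero 2 (by simpa using hΨ X)
  refine top_le_iff.1 ?_
  calc (⊤ : ℝ≥0∞) = ⊤ * volume (boxN N δ) := by
        rw [ENNReal.top_mul]
        rw [volume_boxN]
        exact pow_ne_zero _ (pow_ne_zero _ (by simpa using hδpos))
    _ = ∫⁻ _X in boxN N δ, (⊤ : ℝ≥0∞) := (setLIntegral_const _ _).symm
    _ = ∫⁻ X in boxN N δ,
          kineticDensity Ψ.ψ X + periodicInteraction v L X * (‖Ψ.ψ X‖₊ : ℝ≥0∞) ^ 2 :=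
        setLIntegral_congr_fun (measurableSet_boxN N δ) fun X hX => (hdens X hX).symm
    _ ≤ periodicEnergy v Ψ := lintegral_mono_set (boxN_subset_cellN hδL)

/-- **The finiteness hypothesis `∀ r, v r ≠ ⊤` is what keeps the crux non-vacuous**: for any
potential with a hard core on `[0, R₀)` the WHOLE inner statement of `PuffFloor` holds trivially
(with `C = 0`, any `ρ₀`, all `n ≥ 1`), because `periodicEnergy v Ψ ≠ ⊤` and `∀ X, Ψ X ≠ 0` cannot
both hold. Consequence for planners: a `PuffFloor`-type statement extended verbatim to hard cores
(bypassing `HardCoreExtension`) would be provable for the wrong reason; positivity must then be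
asked only off the core. [folklore] -/
theorem puffFloor_conclusion_vacuous_for_hardCore {v : ℝ → ℝ≥0∞} {R₀ : ℝ} (hR : 0 < R₀)
    (hv : ∀ r, 0 ≤ r → r < R₀ → v r = ⊤) :
    ∃ C : ℝ, 0 ≤ C ∧ ∃ ρ₀ : ℝ, 0 < ρ₀ ∧ ∀ ρ : ℝ, 0 < ρ → ρ < ρ₀ →
      ∀ᶠ n : ℕ in Filter.atTop, ∀ Ψ : PeriodicTrialState (n + 1) (sideLength ρ (n + 1)),
        (let L : ℝ := sideLength ρ (n + 1)
         let S : (Fin 3 → ℤ) → ℝ := fun m => ((n : ℝ) + 1)⁻¹ *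
           ∫ X in cellN (n + 1) L, ‖∑ j : Fin (n + 1), cellWave L m (X j)‖ ^ 2 * ‖Ψ.ψ X‖ ^ 2
         let kn : (Fin 3 → ℤ) → ℝ := fun m => ‖((2 * Real.pi / L) • latticeVec 1 m)‖
         periodicEnergy v Ψ = periodicGroundStateEnergy v (n + 1) L → periodicEnergy v Ψ ≠ ⊤ →
           (∀ X, Ψ.ψ X = (‖Ψ.ψ X‖ : ℂ)) → (∀ X, Ψ.ψ X ≠ 0) →
           ∀ m : Fin 3 → ℤ, m ≠ 0 → kn m / Real.sqrt (kn m ^ 2 + C * ρ) ≤ S m) := by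
  refine ⟨0, le_rfl, 1, one_pos, fun ρ hρ _ => ?_⟩
  filter_upwards [Filter.eventually_ge_atTop 1] with n hn Ψ
  intro L S kn _ hfin _ hne m _
  have hL : 0 < L := Real.rpow_pos_of_pos (by positivity) _
  exact absurd (periodicEnergy_eq_top_of_hardCore hL hR (by omega) hv Ψ hne) hfin

end Summit.AtomisticToContinuum.BoseEinsteinCondensation.Theorems.PuffFloor.Negative

end
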